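import Summits.BirchSwinnertonDyer.BirchSwinnertonDyer.Theses.UniversalToricDescent
import Summits.BirchSwinnertonDyer.BirchSwinnertonDyer.Theorems.UniversalToricDescentSigmaLocalStabilizer
import HarnessLib

/-!
# Stub TS2-TORS of line `sigmacongruence` (crux ♭T≤ stmt-BirchSwinnertonDyer-23042): every `v`-signature is `3`-power torsion

Lead prover `bsd-wall-utd-p1` g17 (stub mode, `--supports stmt-BirchSwinnertonDyer-23042`). THEOREMS ONLY; no definition,
no named fact, no `sorry`. BSD is not proved by any of this.

A `v`-signature is a right-`ker κ`-invariant, left-`D_v`-equivariant `F : Γ_K → H¹(kerD κ v, E′_K[3^∞])` at a place `v ∤ 3`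
finitely decomposed in `K_∞` (`D_v ⊄ ker κ`). Since `κ(D_v) = 3^c ℤ₃` exactly
(`UniversalToricDescentSigmaLocalStabilizer.exists_pow_and_forall_dvd_of_not_le`), every `σ ∈ Γ_K` is `d · γ^i · h` with
`d ∈ D_v`, `i < 3^c`, `h ∈ ker κ` (`γ` a topological generator, `PadicInt.appr`), so `F σ = conj_d (F (γ^i))` takes — up to the
additive automorphisms `conj_d` — only the `3^c` values `F(γ^i)`, each killed by a power of `3`
(`exists_pow_smul_kerD_eq_zero`). Hence one power of `3` kills `F`.

* `exists_decomp_mul_pow_lt_mul_mem_ker` — the bounded form (`i < p^c`) of `exists_decomp_mul_pow_mul_mem_ker`.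
* `stub_twinSignatureTorsion` — the registered stub, verbatim.

References: [GreenbergVatsal2000] §2 p. 24; [Washington1997] §13.1; [GreenbergLNM1716] §1.
-/

set_option autoImplicit false
-- `…BirchSwinnertonDyer.BirchSwinnertonDyer…` is the problem's mandated namespace (D-0017).
set_option linter.dupNamespace false

noncomputable section

open scoped Classical

namespace Summit.BirchSwinnertonDyer.BirchSwinnertonDyer.Cruxes.DefectTransportModThreePT.SigmaCongruence

open WeierstrassCurve NumberField IsDedekindDomain Field
  Literature.NumberTheory.EllipticCurves
  Literature.NumberTheory.EllipticCurves.GreenbergSelmer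
  Literature.NumberTheory.GaloisRepresentations
  Summit.BirchSwinnertonDyer.Rank1Residual Summit.BirchSwinnertonDyer.Rank1Residual.X11b
  Summit.BirchSwinnertonDyer.Rank1Residual.X11b.AcSelmer Summit.BirchSwinnertonDyer.Rank1Residual.X11b.Coinv
  Summit.BirchSwinnertonDyer.BirchSwinnertonDyer.Theorems

/-- **Every `σ ∈ Γ_K` is `d · γ^i · h` with `d ∈ D_v`, `i < p^c`, `h ∈ ker κ`** as soon as `κ(D_v) ⊇ p^c ℤ_p`
(`i` = the residue `PadicInt.appr` of `κ σ` modulo `p^c`; `γ` a topological generator, `κ γ = 1`). Bounded form of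
`UniversalToricDescentSigmaLocalStabilizer.exists_decomp_mul_pow_mul_mem_ker`. [cite: Washington1997, §13.1] -/
theorem exists_decomp_mul_pow_lt_mul_mem_ker {K : Type} [Field K] [NumberField K] {p : ℕ} [Fact p.Prime]
    (κ : ZpExtension K p) {γ : absoluteGaloisGroup K} (hγ : κ.IsTopGenerator γ)
    (v : HeightOneSpectrum (𝓞 K)) {c : ℕ}
    (hc : ∀ z : ℤ_[p], ∃ d : decomp (K := K) v,
      (κ (d : absoluteGaloisGroup K)).toAdd = (p : ℤ_[p]) ^ c * z)
    (σ : absoluteGaloisGroup K) :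
    ∃ (d : decomp (K := K) v) (i : ℕ) (h : absoluteGaloisGroup K), i < p ^ c ∧ h ∈ κ.kerSubgroup ∧
      σ = d * γ ^ i * h := by
  set x : ℤ_[p] := (κ σ).toAdd with hx
  obtain ⟨z, hz⟩ := Ideal.mem_span_singleton.mp (PadicInt.appr_spec c x)
  obtain ⟨d, hd⟩ := hc z
  refine ⟨d, x.appr c, ((d : absoluteGaloisGroup K) * γ ^ x.appr c)⁻¹ * σ, PadicInt.appr_lt x c, ?_, ?_⟩
  · rw [ZpExtension.mem_kerSubgroup, map_mul, map_inv, map_mul, map_pow,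
      show κ γ = Multiplicative.ofAdd 1 from hγ, ← ofAdd_nsmul]
    apply Multiplicative.toAdd.injective
    rw [toAdd_mul, toAdd_inv, toAdd_mul, toAdd_ofAdd, toAdd_one, hd, nsmul_eq_mul, mul_one, ← hx]
    linear_combination hz
  · rw [mul_inv_cancel_left]

/-- **STUB TS2-TORS (v6) — PROVED**: every `v`-signature `F : Γ_K → H¹(kerD κ v, E′_K[3^∞])` (right-`ker κ`-invariant,
left-`D_v`-equivariant) at a finitely decomposed `v ∤ 3` is killed by a power of `3`: `F σ = conj_d F(γ^i)` (`σ = d γ^i h`,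
`i < 3^c`), and each of the finitely many `F(γ^i)` is `3`-power torsion. [cite: GreenbergVatsal2000, §2 p. 24]
[cite: Washington1997, §13.1] -/
theorem stub_twinSignatureTorsion :
    ∀ (W' : WeierstrassCurve ℚ) [W'.IsElliptic] (K : Type) [Field K] [NumberField K] (κ : ZpExtension K 3)
      (v : HeightOneSpectrum (𝓞 K)), ((3 : ℕ) : 𝓞 K) ∉ v.asIdeal → ¬ (decomp v ≤ κ.kerSubgroup) →
      ∀ (F : (absoluteGaloisGroup K → subgroupH1 (kerD κ v) ((W'.baseChange K).geomPrimaryTorsion 3))),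
      (∀ (σ h : absoluteGaloisGroup K), h ∈ κ.kerSubgroup → F (σ * h) = F σ) →
      (∀ (d : decomp (K := K) v) (σ : absoluteGaloisGroup K), F ((d : absoluteGaloisGroup K) * σ) =
        conjH1 (kerD κ v) ((W'.baseChange K).geomPrimaryTorsion 3) d (F σ)) →
      ∃ k : ℕ, 3 ^ k • F = 0 := by
  intro W' _ K _ _ κ v _ hvd F hFH hFD
  haveI : Fact (Nat.Prime 3) := ⟨Nat.prime_three⟩
  -- a topological generator and the exact index of `D_v`
  obtain ⟨γ, hγ⟩ : ∃ γ : absoluteGaloisGroup K, κ.IsTopGenerator γ := κ.surjective (Multiplicative.ofAdd 1)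
  obtain ⟨c, -, hc, -⟩ := UniversalToricDescentSigmaLocalStabilizer.exists_pow_and_forall_dvd_of_not_le κ v hvd
  -- each value is `3`-power torsion
  have htor : ∀ m : (W'.baseChange K).geomPrimaryTorsion 3, ∃ k : ℕ, 3 ^ k • m = 0 :=
    isPrimaryTorsion_geomPrimaryTorsion (W'.baseChange K) 3
  have hval : ∀ i : ℕ, ∃ k : ℕ, 3 ^ k • F (γ ^ i) = 0 := fun i ↦
    UniversalToricDescentSigmaLocalStabilizer.exists_pow_smul_kerD_eq_zero κ htor v (F (γ ^ i))
  choose kf hkf using hval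
  refine ⟨(Finset.range (3 ^ c)).sup kf, funext fun σ ↦ ?_⟩
  obtain ⟨d, i, h, hi, hh, rfl⟩ := exists_decomp_mul_pow_lt_mul_mem_ker κ hγ v hc σ
  rw [Pi.smul_apply, Pi.zero_apply, hFH _ _ hh, hFD d (γ ^ i)]
  obtain ⟨j, hj⟩ := Nat.exists_eq_add_of_le (Finset.le_sup (f := kf) (Finset.mem_range.mpr hi))
  rw [← map_nsmul, hj, pow_add, mul_comm, mul_smul, hkf i, smul_zero, map_zero]

end Summit.BirchSwinnertonDyer.BirchSwinnertonDyer.Cruxes.DefectTransportModThreePT.SigmaCongruence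

end
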